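import Mathlib
import Literature.Analysis.FluidPDE.VectorCalculus
import Literature.Analysis.FluidPDE.LeiZhang2011Proofs

/-!
# A junk direction of the normal-variation clause of the tilted box block (`TransverseReductionR` / `SelectionBoxR`)

Refutation-first lane `ns-filament-19175-p1` (crux stmt-NavierStokesRegularity-19175), kernel-checked companion of
the desk audit `JUNK-AUDIT-19175.md` (evidence on the item).  Clause 13 of the box block (the `cnd`
"normal-variation" clause) tests, for every `C²` normal family `Y` with
`‖Y‖ + ‖Y′‖ + ‖Y″‖ ≤ (1 + |τ − c_j|)^b`, the size of
`deriv (fun s => T p (X + s • Y) j τ) 0`, where `T` is built from the regularised Biot–Savart field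
`u p Z y = Σ_k (Γγ_k/4π) • ∫ (‖y − Z_kσ‖² + 1)^(−3/2) • Z′_kσ × (y − Z_kσ) dσ` of the PERTURBED filaments
`Z = X + s • Y` — a Bochner integral over `ℝ`, which Lean sets to `0` when the integrand is not integrable.

This file shows, on the simplest filament (the straight line `σ ↦ σ t`), that for growth exponent
`b = 1` the test class contains a direction along which that integral is switched off:

* `testField_admissible` — `Y(σ) = (σ sin σ / 3) • n` (`n ⊥ t` unit) is `C²`, normal to the line, and
  obeys `‖Y‖ + ‖Y′‖ + ‖Y″‖ ≤ (1 + |σ|)^1`;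
* `not_integrable_perturbedLine` — for every `s ≠ 0` and EVERY point `y`, the regularised Biot–Savart
  integrand of the perturbed line `Z = σ t + s Y(σ)` is not integrable over `ℝ` (its `t × n`-component
  is `s σ² cos σ/3 · (‖y − Z‖² + 1)^(−3/2) ≍ cos σ/σ`, and `|cos σ|/σ ∉ L¹(R, ∞)` by harmonic blocks,
  `not_integrableOn_abs_cos_div`);
* `integral_perturbedLine_eq_zero` — hence Lean's `∫` of it is `0`: the perturbed field vanishes
  identically for `s ≠ 0` while the unperturbed one (`s = 0`) is the genuine field, so
  `s ↦ T p (X + s•Y) j τ` is discontinuous at `0` wherever the genuine field has a normal component and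
  `deriv … 0` returns junk `0` there.

Consequence recorded in the audit: the box class of the crux is junk-restricted for every `b ≥ 1`
(the same oscillation `A(σ) cos φ(σ)` with `Aφ′ ≍ σ/log σ`, `φ′ ≍ σ^(b−1)` works along any `C³` tail),
so the sibling crux `SelectionBoxR` should be witnessed with `b < 1`, where dominated differentiation
makes the clause junk-free.  Negative-side bookkeeping only; NOT a claim about NS regularity or
blow-up, and not a refutation of the crux (its `b < 1` slice is untouched).
-/

set_option linter.dupNamespace false

noncomputable section

namespace Summit.NavierStokesRegularity.NavierStokesRegularity.Theorems

open Set Function Filter MeasureTheory Real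
open Literature.Analysis.FluidPDE
open scoped InnerProductSpace Topology

namespace NormalVariationJunk

/-- `cos x ≥ 1/2` on the block `|x − 2πk| ≤ π/3`. [folklore] -/
theorem half_le_cos_of_abs_sub_le {x : ℝ} (k : ℕ) (hx : |x - 2 * π * k| ≤ π / 3) :
    1 / 2 ≤ Real.cos x := by
  have h : Real.cos x = Real.cos (|x - 2 * π * k|) := by
    rw [Real.cos_abs, show x - 2 * π * k = x - (k:ℤ) * (2 * π) by push_cast; ring,
      Real.cos_sub_int_mul_two_pi]
  rw [h, ← Real.cos_pi_div_three]
  exact Real.cos_le_cos_of_nonneg_of_le_pi (abs_nonneg _) (by linarith [Real.pi_pos]) hx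

/-- `(x²)^{3/2} = x³` for `x ≥ 0`. [folklore] -/
theorem sq_rpow_three_halves {x : ℝ} (hx : 0 ≤ x) : (x ^ 2) ^ (3/2:ℝ) = x ^ 3 := by
  rw [← Real.rpow_natCast x 2, ← Real.rpow_mul hx]
  norm_num

/-- `∫_{|x − 2πm| ≤ π/3} |cos x|/x dx ≥ 1/(6(m+1))` for `m ≥ 1`. [folklore] -/
theorem block_integral_ge (m : ℕ) (hm : 1 ≤ m)
    (hint : IntegrableOn (fun σ : ℝ => |Real.cos σ| / σ) (Icc (2 * π * m - π / 3) (2 * π * m + π / 3))) :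
    1 / (6 * ((m:ℝ) + 1)) ≤ ∫ σ in Icc (2 * π * m - π / 3) (2 * π * m + π / 3), |Real.cos σ| / σ := by
  have hπ := Real.pi_pos
  have hm' : (1:ℝ) ≤ m := by exact_mod_cast hm
  have hlow : ∀ σ ∈ Icc (2 * π * m - π / 3) (2 * π * m + π / 3),
      1 / (4 * π * ((m:ℝ) + 1)) ≤ |Real.cos σ| / σ := by
    intro σ hσ
    have hσpos : 0 < σ := by
      have : 2 * π * 1 - π / 3 ≤ σ := le_trans (by nlinarith) hσ.1
      linarith
    have hcos : 1 / 2 ≤ |Real.cos σ| :=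
      (half_le_cos_of_abs_sub_le m (abs_le.2 ⟨by linarith [hσ.1], by linarith [hσ.2]⟩)).trans
        (le_abs_self _)
    have hσle : σ ≤ 2 * π * ((m:ℝ) + 1) := by linarith [hσ.2]
    rw [div_le_div_iff₀ (by positivity) hσpos]
    nlinarith
  have hvol : volume.real (Icc (2 * π * m - π / 3) (2 * π * m + π / 3)) = 2 * π / 3 := by
    rw [Real.volume_real_Icc_of_le (by linarith)]
    ring
  have h := setIntegral_ge_of_const_le_real (μ := volume) measurableSet_Icc
    (by rw [Real.volume_Icc]; exact ENNReal.ofReal_ne_top) hlow hint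
  rw [hvol] at h
  calc 1 / (6 * ((m:ℝ) + 1)) = 1 / (4 * π * ((m:ℝ) + 1)) * (2 * π / 3) := by field_simp; ring
    _ ≤ _ := by linarith

/-- `|cos σ|/σ` is not integrable at `+∞` (harmonic blocks). [folklore] -/
theorem not_integrableOn_abs_cos_div (R : ℝ) :
    ¬ IntegrableOn (fun σ : ℝ => |Real.cos σ| / σ) (Ioi R) := by
  intro hint
  have hπ := Real.pi_pos
  set R' : ℝ := max R 1 with hR'
  have hR1 : 1 ≤ R' := le_max_right _ _
  have hint' : IntegrableOn (fun σ : ℝ => |Real.cos σ| / σ) (Ioi R') :=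
    hint.mono_set (Ioi_subset_Ioi (le_max_left _ _))
  set k₀ : ℕ := ⌈R'⌉₊ + 1 with hk₀
  have hk₀R : R' ≤ (k₀:ℝ) - 1 := by
    rw [hk₀]; push_cast; linarith [Nat.le_ceil R']
  have hk₀1 : (1:ℝ) ≤ k₀ := by linarith
  set I : ℕ → Set ℝ := fun k => Icc (2 * π * ((k₀ + k : ℕ):ℝ) - π / 3) (2 * π * ((k₀ + k : ℕ):ℝ) + π / 3)
    with hI
  have hIsub : ∀ k, I k ⊆ Ioi R' := fun k σ hσ => by
    simp only [hI, mem_Icc, Nat.cast_add] at hσ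
    simp only [mem_Ioi]
    have h0 : (0:ℝ) ≤ k := Nat.cast_nonneg k
    have h1 : 2 * π * (R' + 1) ≤ 2 * π * ((k₀:ℝ) + k) :=
      mul_le_mul_of_nonneg_left (by linarith) (by positivity)
    have h2 : 3 * R' ≤ π * R' := by nlinarith [Real.pi_gt_three]
    linarith [Real.pi_gt_three, hσ.1]
  have hkey : ∀ j k : ℕ, j < k → Disjoint (I j) (I k) := fun j k hlt => by
    rw [hI, Set.disjoint_iff]
    intro σ ⟨hσj, hσk⟩
    simp only [mem_Icc, Nat.cast_add] at hσj hσk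
    have : (j:ℝ) + 1 ≤ k := by exact_mod_cast hlt
    nlinarith [hσj.2, hσk.1, Real.pi_gt_three]
  have hIdisj : Pairwise (Disjoint on I) := fun j k hjk => by
    rcases lt_or_gt_of_ne hjk with h | h
    · exact hkey j k h
    · exact (hkey k j h).symm
  have hsum : ∀ K : ℕ, ∑ k ∈ Finset.range K, 1 / (6 * (((k₀ + k : ℕ):ℝ) + 1)) ≤
      ∫ σ in Ioi R', |Real.cos σ| / σ := fun K => by
    calc ∑ k ∈ Finset.range K, 1 / (6 * (((k₀ + k : ℕ):ℝ) + 1))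
        ≤ ∑ k ∈ Finset.range K, ∫ σ in I k, |Real.cos σ| / σ :=
          Finset.sum_le_sum fun k _ => block_integral_ge (k₀ + k) (by omega) (hint'.mono_set (hIsub k))
      _ = ∫ σ in ⋃ k ∈ Finset.range K, I k, |Real.cos σ| / σ :=
          (integral_biUnion_finset _ (fun k _ => measurableSet_Icc) (fun j _ k _ hjk => hIdisj hjk)
            (fun k _ => hint'.mono_set (hIsub k))).symm
      _ ≤ ∫ σ in Ioi R', |Real.cos σ| / σ := by
          refine setIntegral_mono_set hint' ?_ (Eventually.of_forall (iUnion₂_subset fun k _ => hIsub k))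
          refine ae_restrict_of_forall_mem measurableSet_Ioi fun σ hσ => ?_
          exact div_nonneg (abs_nonneg _) (by linarith [mem_Ioi.1 hσ])
  -- harmonic divergence: `1/(m+1) ≥ log (m+2) − log (m+1)`
  have hlog : ∀ K : ℕ, Real.log ((k₀:ℝ) + K + 1) - Real.log ((k₀:ℝ) + 1) ≤
      6 * ∫ σ in Ioi R', |Real.cos σ| / σ := fun K => by
    have htel : ∑ k ∈ Finset.range K, (Real.log ((k₀:ℝ) + (k + 1 : ℕ) + 1) - Real.log ((k₀:ℝ) + k + 1))
        = Real.log ((k₀:ℝ) + K + 1) - Real.log ((k₀:ℝ) + 1) := by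
      have := Finset.sum_range_sub (fun k : ℕ => Real.log ((k₀:ℝ) + k + 1)) K
      simpa using this
    have hterm : ∀ k ∈ Finset.range K, Real.log ((k₀:ℝ) + (k + 1 : ℕ) + 1) - Real.log ((k₀:ℝ) + k + 1)
        ≤ 6 * (1 / (6 * (((k₀ + k : ℕ):ℝ) + 1))) := by
      intro k _
      have hpos : (0:ℝ) < (k₀:ℝ) + k + 1 := by positivity
      rw [← Real.log_div (by positivity) hpos.ne']
      have h1 := Real.log_le_sub_one_of_pos (show (0:ℝ) < ((k₀:ℝ) + (k + 1 : ℕ) + 1) / ((k₀:ℝ) + k + 1) by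
        positivity)
      refine h1.trans (le_of_eq ?_)
      push_cast
      field_simp
      ring
    rw [← htel]
    calc ∑ k ∈ Finset.range K, (Real.log ((k₀:ℝ) + (k + 1 : ℕ) + 1) - Real.log ((k₀:ℝ) + k + 1))
        ≤ ∑ k ∈ Finset.range K, 6 * (1 / (6 * (((k₀ + k : ℕ):ℝ) + 1))) := Finset.sum_le_sum hterm
      _ = 6 * ∑ k ∈ Finset.range K, 1 / (6 * (((k₀ + k : ℕ):ℝ) + 1)) := by rw [Finset.mul_sum]
      _ ≤ 6 * ∫ σ in Ioi R', |Real.cos σ| / σ := by gcongr; exact hsum K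
  -- choose K with log (k₀ + K + 1) too large
  set V : ℝ := 6 * ∫ σ in Ioi R', |Real.cos σ| / σ with hV
  set K : ℕ := ⌈Real.exp (V + Real.log ((k₀:ℝ) + 1) + 1)⌉₊ with hK
  have hKge : Real.exp (V + Real.log ((k₀:ℝ) + 1) + 1) ≤ (K:ℝ) := Nat.le_ceil _
  have h1 : V + Real.log ((k₀:ℝ) + 1) + 1 ≤ Real.log ((k₀:ℝ) + K + 1) := by
    rw [Real.le_log_iff_exp_le (by positivity)]
    linarith [Real.exp_pos (V + Real.log ((k₀:ℝ) + 1) + 1)]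
  linarith [hlog K]

/-! ### The test field `Y(σ) = (σ sin σ / 3) n` and the switched-off Biot–Savart integral -/

/-- Coordinate expansion used below:
`⟪(t + a n) × (y − σ t − c n), w⟫ = ⟪t × y, w⟫ + a ⟪n × y, w⟫ + (aσ − c) ⟪t × n, w⟫`. [folklore] -/
theorem inner_cross_expand (t n y w : EuclideanSpace ℝ (Fin 3)) (a c σ : ℝ) :
    ⟪cross (t + a • n) (y - (σ • t + c • n)), w⟫_ℝ =
      ⟪cross t y, w⟫_ℝ + a * ⟪cross n y, w⟫_ℝ + (a * σ - c) * ⟪cross t n, w⟫_ℝ := by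
  simp [cross, crossProduct, PiLp.inner_apply, Fin.sum_univ_three]
  ring

/-- `‖t × n‖ = 1` for orthogonal unit vectors. [folklore] -/
theorem norm_cross_of_orthonormal {t n : EuclideanSpace ℝ (Fin 3)} (ht : ‖t‖ = 1) (hn : ‖n‖ = 1)
    (htn : ⟪t, n⟫_ℝ = 0) : ‖cross t n‖ = 1 := by
  rw [norm_cross, ht, hn, (InnerProductGeometry.inner_eq_zero_iff_angle_eq_pi_div_two t n).1 htn,
    Real.sin_pi_div_two]
  norm_num

/-- The test field `Y(σ) = (σ sin σ / 3) • n` is smooth. [folklore] -/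
theorem contDiff_testField (n : EuclideanSpace ℝ (Fin 3)) :
    ContDiff ℝ 2 (fun σ : ℝ => (σ * Real.sin σ / 3) • n) :=
  ((contDiff_id.mul Real.contDiff_sin).div_const 3).smul contDiff_const

/-- Derivatives of the test field: `Y′(σ) = ((sin σ + σ cos σ)/3) • n`. [folklore] -/
theorem hasDerivAt_testField (n : EuclideanSpace ℝ (Fin 3)) (σ : ℝ) :
    HasDerivAt (fun σ : ℝ => (σ * Real.sin σ / 3) • n) (((Real.sin σ + σ * Real.cos σ) / 3) • n) σ := by
  have h2 : HasDerivAt (fun σ : ℝ => σ * Real.sin σ / 3) ((1 * Real.sin σ + σ * Real.cos σ) / 3) σ :=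
    ((hasDerivAt_id σ).mul (Real.hasDerivAt_sin σ)).div_const 3
  simpa using h2.smul_const n

/-- `Y″(σ) = ((2 cos σ − σ sin σ)/3) • n`. [folklore] -/
theorem hasDerivAt_deriv_testField (n : EuclideanSpace ℝ (Fin 3)) (σ : ℝ) :
    HasDerivAt (fun σ : ℝ => ((Real.sin σ + σ * Real.cos σ) / 3) • n)
      (((2 * Real.cos σ - σ * Real.sin σ) / 3) • n) σ := by
  have h2 : HasDerivAt (fun σ : ℝ => (Real.sin σ + σ * Real.cos σ) / 3)
      ((Real.cos σ + (1 * Real.cos σ + σ * -Real.sin σ)) / 3) σ :=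
    ((Real.hasDerivAt_sin σ).add ((hasDerivAt_id' σ).mul (Real.hasDerivAt_cos σ))).div_const 3
  refine (h2.smul_const n).congr_deriv ?_
  congr 1
  ring

/-- The test field is ADMISSIBLE for clause 13 with `b = 1` along the straight filament `σ ↦ σ t`
(waist parameter `c = 0`): it is normal to `t` and `‖Y‖ + ‖Y′‖ + ‖Y″‖ ≤ 1 + |σ|`. [folklore] -/
theorem testField_admissible {t n : EuclideanSpace ℝ (Fin 3)} (hn : ‖n‖ = 1) (htn : ⟪t, n⟫_ℝ = 0)
    (σ : ℝ) :
    ⟪(σ * Real.sin σ / 3) • n, t⟫_ℝ = 0 ∧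
    ‖(σ * Real.sin σ / 3) • n‖ + ‖deriv (fun σ : ℝ => (σ * Real.sin σ / 3) • n) σ‖ +
      ‖iteratedDeriv 2 (fun σ : ℝ => (σ * Real.sin σ / 3) • n) σ‖ ≤ (1 + |σ - 0|) ^ (1:ℝ) := by
  refine ⟨by rw [real_inner_smul_left, real_inner_comm, htn, mul_zero], ?_⟩
  have hd1 : deriv (fun σ : ℝ => (σ * Real.sin σ / 3) • n) =
      fun σ => ((Real.sin σ + σ * Real.cos σ) / 3) • n := funext fun σ => (hasDerivAt_testField n σ).deriv
  have hd2 : iteratedDeriv 2 (fun σ : ℝ => (σ * Real.sin σ / 3) • n) σ =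
      ((2 * Real.cos σ - σ * Real.sin σ) / 3) • n := by
    rw [iteratedDeriv_succ, iteratedDeriv_one, hd1]
    exact (hasDerivAt_deriv_testField n σ).deriv
  rw [hd1, hd2, Real.rpow_one, sub_zero]
  simp only [norm_smul, Real.norm_eq_abs, hn, mul_one]
  have hs := Real.abs_sin_le_one σ
  have hc := Real.abs_cos_le_one σ
  have h1 : |σ * Real.sin σ / 3| ≤ |σ| / 3 := by
    rw [abs_div, abs_mul, abs_of_pos (by norm_num : (0:ℝ) < 3)]
    gcongr
    nlinarith [abs_nonneg σ]
  have h2 : |(Real.sin σ + σ * Real.cos σ) / 3| ≤ (1 + |σ|) / 3 := by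
    rw [abs_div, abs_of_pos (by norm_num : (0:ℝ) < 3)]
    gcongr
    calc |Real.sin σ + σ * Real.cos σ| ≤ |Real.sin σ| + |σ * Real.cos σ| := abs_add_le _ _
      _ ≤ 1 + |σ| := by rw [abs_mul]; nlinarith [abs_nonneg σ]
  have h3 : |(2 * Real.cos σ - σ * Real.sin σ) / 3| ≤ (2 + |σ|) / 3 := by
    rw [abs_div, abs_of_pos (by norm_num : (0:ℝ) < 3)]
    gcongr
    calc |2 * Real.cos σ - σ * Real.sin σ| ≤ |2 * Real.cos σ| + |σ * Real.sin σ| := abs_sub _ _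
      _ ≤ 2 + |σ| := by rw [abs_mul, abs_mul, abs_two]; nlinarith [abs_nonneg σ]
  linarith

/-- **The perturbed Biot–Savart integrand is NOT integrable.** Along the straight filament `σ ↦ σ t`
perturbed by `s Y`, `Y(σ) = (σ sin σ/3) n` (`t ⊥ n` unit vectors, `s ≠ 0`), the regularised
Biot–Savart integrand `(‖y − Z(σ)‖² + 1)^{−3/2} Z′(σ) × (y − Z(σ))`, `Z = σ t + s Y(σ)`, is not Bochner
integrable over `ℝ` at ANY point `y`: its component along `t × n` is `≍ s σ² cos σ /(3‖y − Z‖³) ≍ cos σ/σ`,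
and `|cos σ|/σ ∉ L¹` (`not_integrableOn_abs_cos_div`). [folklore] -/
theorem not_integrable_perturbedLine (t n y : EuclideanSpace ℝ (Fin 3)) (ht : ‖t‖ = 1) (hn : ‖n‖ = 1)
    (htn : ⟪t, n⟫_ℝ = 0) {s : ℝ} (hs : s ≠ 0) :
    ¬ Integrable (fun σ : ℝ => ((‖y - (σ • t + s • ((σ * Real.sin σ / 3) • n))‖ ^ 2 + 1) ^ (3/2:ℝ))⁻¹ •
      cross (deriv (fun σ : ℝ => σ • t + s • ((σ * Real.sin σ / 3) • n)) σ)
        (y - (σ • t + s • ((σ * Real.sin σ / 3) • n)))) := by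
  intro hF
  set b := cross t n with hb_def
  have hb : ‖b‖ = 1 := norm_cross_of_orthonormal ht hn htn
  have hbb : ⟪b, b⟫_ℝ = 1 := by rw [real_inner_self_eq_norm_sq, hb, one_pow]
  have hZ' : ∀ σ, deriv (fun σ : ℝ => σ • t + s • ((σ * Real.sin σ / 3) • n)) σ
      = t + (s * ((Real.sin σ + σ * Real.cos σ) / 3)) • n := fun σ => by
    have h1 : HasDerivAt (fun σ : ℝ => σ • t) ((1:ℝ) • t) σ := (hasDerivAt_id' σ).smul_const t
    have h3 : HasDerivAt (fun σ : ℝ => s • ((σ * Real.sin σ / 3) • n))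
        (s • (((Real.sin σ + σ * Real.cos σ) / 3) • n)) σ := (hasDerivAt_testField n σ).const_smul s
    rw [(h1.fun_add h3).deriv, one_smul, smul_smul]
  -- constants
  set c₀ : ℝ := ⟪cross t y, b⟫_ℝ with hc₀
  set c₁ : ℝ := ⟪cross n y, b⟫_ℝ with hc₁
  have hc₀le : |c₀| ≤ ‖y‖ := by
    refine (abs_real_inner_le_norm _ _).trans ?_
    rw [hb, mul_one]
    exact (norm_cross_le_norm_mul_norm _ _).trans (by rw [ht, one_mul])
  have hc₁le : |c₁| ≤ ‖y‖ := by
    refine (abs_real_inner_le_norm _ _).trans ?_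
    rw [hb, mul_one]
    exact (norm_cross_le_norm_mul_norm _ _).trans (by rw [hn, one_mul])
  set M : ℝ := 2 + |s| / 3 with hM
  set A : ℝ := 3 * (M ^ 2 + 1) ^ (3/2:ℝ) / |s| with hA
  have hspos : 0 < |s| := abs_pos.2 hs
  set R₀ : ℝ := ‖y‖ + 1 with hR₀
  -- the scalar component is integrable
  have hg : Integrable (fun σ : ℝ => ⟪((‖y - (σ • t + s • ((σ * Real.sin σ / 3) • n))‖ ^ 2 + 1) ^ (3/2:ℝ))⁻¹ •
      cross (deriv (fun σ : ℝ => σ • t + s • ((σ * Real.sin σ / 3) • n)) σ)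
        (y - (σ • t + s • ((σ * Real.sin σ / 3) • n))), b⟫_ℝ) := hF.inner_const b
  -- domination of |cos σ|/σ on `Ioi R₀`
  have hdom : ∀ σ ∈ Ioi R₀, |Real.cos σ| / σ ≤
      A * |⟪((‖y - (σ • t + s • ((σ * Real.sin σ / 3) • n))‖ ^ 2 + 1) ^ (3/2:ℝ))⁻¹ •
        cross (deriv (fun σ : ℝ => σ • t + s • ((σ * Real.sin σ / 3) • n)) σ)
        (y - (σ • t + s • ((σ * Real.sin σ / 3) • n))), b⟫_ℝ| +
      (3 * ‖y‖ / |s| + ‖y‖) * (σ ^ 3)⁻¹ + ‖y‖ * (σ ^ 2)⁻¹ := by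
    intro σ hσ
    rw [mem_Ioi] at hσ
    have hσ1 : 1 ≤ σ := by linarith [norm_nonneg y]
    have hσ0 : 0 < σ := by linarith
    have hyσ : ‖y‖ ≤ σ := by linarith
    rw [hZ' σ]
    set Δ := y - (σ • t + s • ((σ * Real.sin σ / 3) • n)) with hΔ
    set D : ℝ := (‖Δ‖ ^ 2 + 1) ^ (3/2:ℝ) with hD
    have hDpos : 0 < D := Real.rpow_pos_of_pos (by positivity) _
    set e : ℝ := ⟪D⁻¹ • cross (t + (s * ((Real.sin σ + σ * Real.cos σ) / 3)) • n) Δ, b⟫_ℝ with he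
    -- expand the component
    have hexp : e = D⁻¹ * (c₀ + s * ((Real.sin σ + σ * Real.cos σ) / 3) * c₁ +
        s * σ ^ 2 * Real.cos σ / 3) := by
      rw [he, real_inner_smul_left, hΔ, smul_smul, inner_cross_expand, ← hb_def, hbb, ← hc₀, ← hc₁]
      ring
    -- size of Δ
    have hΔle : ‖Δ‖ ≤ M * σ := by
      rw [hΔ, hM]
      calc ‖y - (σ • t + s • ((σ * Real.sin σ / 3) • n))‖
          ≤ ‖y‖ + ‖σ • t + s • ((σ * Real.sin σ / 3) • n)‖ := norm_sub_le _ _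
        _ ≤ ‖y‖ + (‖σ • t‖ + ‖s • ((σ * Real.sin σ / 3) • n)‖) := by gcongr; exact norm_add_le _ _
        _ = ‖y‖ + (σ + |s| * (|σ * Real.sin σ / 3|)) := by
            rw [norm_smul, norm_smul, norm_smul, Real.norm_eq_abs, abs_of_pos hσ0, ht, mul_one,
              Real.norm_eq_abs, Real.norm_eq_abs, hn, mul_one]
        _ ≤ σ + (σ + |s| * (σ / 3)) := by
            gcongr
            rw [abs_div, abs_mul, abs_of_pos hσ0, abs_of_pos (by norm_num : (0:ℝ) < 3)]
            gcongr
            nlinarith [Real.abs_sin_le_one σ]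
        _ = (2 + |s| / 3) * σ := by ring
    have hDle : D ≤ (M ^ 2 + 1) ^ (3/2:ℝ) * σ ^ 3 := by
      rw [hD, ← sq_rpow_three_halves hσ0.le, ← Real.mul_rpow (by positivity) (by positivity)]
      refine Real.rpow_le_rpow (by positivity) ?_ (by norm_num)
      have : ‖Δ‖ ^ 2 ≤ (M * σ) ^ 2 := pow_le_pow_left₀ (norm_nonneg _) hΔle 2
      nlinarith
    -- key inequality
    have hkey : |s| * σ ^ 2 * |Real.cos σ| / 3 ≤
        (M ^ 2 + 1) ^ (3/2:ℝ) * σ ^ 3 * |e| + ‖y‖ + |s| * ((1 + σ) / 3) * ‖y‖ := by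
      have h1 : s * σ ^ 2 * Real.cos σ / 3 =
          D * e - c₀ - s * ((Real.sin σ + σ * Real.cos σ) / 3) * c₁ := by
        rw [hexp]; field_simp; ring
      have h2 : |s| * σ ^ 2 * |Real.cos σ| / 3 = |s * σ ^ 2 * Real.cos σ / 3| := by
        rw [abs_div, abs_mul, abs_mul, abs_of_pos (by positivity : (0:ℝ) < σ ^ 2),
          abs_of_pos (by norm_num : (0:ℝ) < 3)]
      rw [h2, h1]
      have ha : |s * ((Real.sin σ + σ * Real.cos σ) / 3)| ≤ |s| * ((1 + σ) / 3) := by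
        rw [abs_mul, abs_div, abs_of_pos (by norm_num : (0:ℝ) < 3)]
        gcongr
        calc |Real.sin σ + σ * Real.cos σ| ≤ |Real.sin σ| + |σ * Real.cos σ| := abs_add_le _ _
          _ ≤ 1 + σ := by
              rw [abs_mul, abs_of_pos hσ0]
              nlinarith [Real.abs_sin_le_one σ, Real.abs_cos_le_one σ]
      calc |D * e - c₀ - s * ((Real.sin σ + σ * Real.cos σ) / 3) * c₁|
          ≤ |D * e - c₀| + |s * ((Real.sin σ + σ * Real.cos σ) / 3) * c₁| := abs_sub _ _
        _ ≤ (|D * e| + |c₀|) + |s * ((Real.sin σ + σ * Real.cos σ) / 3)| * |c₁| := by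
            rw [abs_mul (s * _)]; gcongr; exact abs_sub _ _
        _ ≤ (D * |e| + ‖y‖) + |s| * ((1 + σ) / 3) * ‖y‖ := by
            rw [abs_mul, abs_of_pos hDpos]; gcongr
        _ ≤ ((M ^ 2 + 1) ^ (3/2:ℝ) * σ ^ 3 * |e| + ‖y‖) + |s| * ((1 + σ) / 3) * ‖y‖ := by gcongr
    -- divide by |s| σ³ / 3
    have hfac : 0 < 3 / (|s| * σ ^ 3) := by positivity
    calc |Real.cos σ| / σ = 3 / (|s| * σ ^ 3) * (|s| * σ ^ 2 * |Real.cos σ| / 3) := by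
          field_simp
      _ ≤ 3 / (|s| * σ ^ 3) * ((M ^ 2 + 1) ^ (3/2:ℝ) * σ ^ 3 * |e| + ‖y‖ + |s| * ((1 + σ) / 3) * ‖y‖) :=
          mul_le_mul_of_nonneg_left hkey hfac.le
      _ = A * |e| + (3 * ‖y‖ / |s| + ‖y‖) * (σ ^ 3)⁻¹ + ‖y‖ * (σ ^ 2)⁻¹ := by
          rw [hA]; field_simp; ring
  -- hence |cos σ|/σ would be integrable on `Ioi R₀`
  have hR₀ : 0 < R₀ := by rw [hR₀]; positivity
  have hI3 : IntegrableOn (fun σ : ℝ => (σ ^ 3)⁻¹) (Ioi R₀) := by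
    refine ((integrableOn_Ioi_rpow_of_lt (by norm_num : (-3:ℝ) < -1) hR₀).congr_fun ?_
      measurableSet_Ioi)
    intro σ hσ
    have hσ0 : 0 < σ := hR₀.trans hσ
    simp only
    rw [Real.rpow_neg hσ0.le, show (3:ℝ) = ((3:ℕ):ℝ) by norm_num, Real.rpow_natCast]
  have hI2 : IntegrableOn (fun σ : ℝ => (σ ^ 2)⁻¹) (Ioi R₀) := by
    refine ((integrableOn_Ioi_rpow_of_lt (by norm_num : (-2:ℝ) < -1) hR₀).congr_fun ?_
      measurableSet_Ioi)
    intro σ hσ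
    have hσ0 : 0 < σ := hR₀.trans hσ
    simp only
    rw [Real.rpow_neg hσ0.le, show (2:ℝ) = ((2:ℕ):ℝ) by norm_num, Real.rpow_natCast]
  have hG : IntegrableOn (fun σ : ℝ =>
      A * |⟪((‖y - (σ • t + s • ((σ * Real.sin σ / 3) • n))‖ ^ 2 + 1) ^ (3/2:ℝ))⁻¹ •
        cross (deriv (fun σ : ℝ => σ • t + s • ((σ * Real.sin σ / 3) • n)) σ)
        (y - (σ • t + s • ((σ * Real.sin σ / 3) • n))), b⟫_ℝ| +
      (3 * ‖y‖ / |s| + ‖y‖) * (σ ^ 3)⁻¹ + ‖y‖ * (σ ^ 2)⁻¹) (Ioi R₀) :=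
    ((hg.abs.const_mul A).integrableOn.add (hI3.const_mul _)).add (hI2.const_mul _)
  have hmeas : AEStronglyMeasurable (fun σ : ℝ => |Real.cos σ| / σ) (volume.restrict (Ioi R₀)) :=
    ((continuous_abs.measurable.comp Real.continuous_cos.measurable).div
      measurable_id).aestronglyMeasurable
  have hcos : IntegrableOn (fun σ : ℝ => |Real.cos σ| / σ) (Ioi R₀) := by
    refine Integrable.mono' hG hmeas (ae_restrict_of_forall_mem measurableSet_Ioi fun σ hσ => ?_)
    rw [Real.norm_eq_abs, abs_of_nonneg (div_nonneg (abs_nonneg _) (hR₀.trans hσ).le)]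
    exact hdom σ hσ
  exact not_integrableOn_abs_cos_div R₀ hcos

/-- **The Bochner junk value.** Consequently Lean's `∫` of the perturbed integrand is `0` for every
`s ≠ 0` and every `y` (`MeasureTheory.integral_undef`): the regularised Biot–Savart field of the
perturbed straight filament, as written in clause 13 of `TransverseReductionR`/`SelectionBoxR`, is
SWITCHED OFF identically, although the genuine field of the curve `Z` is nowhere zero near it. [folklore] -/
theorem integral_perturbedLine_eq_zero (t n y : EuclideanSpace ℝ (Fin 3)) (ht : ‖t‖ = 1)
    (hn : ‖n‖ = 1) (htn : ⟪t, n⟫_ℝ = 0) {s : ℝ} (hs : s ≠ 0) :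
    ∫ σ : ℝ, ((‖y - (σ • t + s • ((σ * Real.sin σ / 3) • n))‖ ^ 2 + 1) ^ (3/2:ℝ))⁻¹ •
      cross (deriv (fun σ : ℝ => σ • t + s • ((σ * Real.sin σ / 3) • n)) σ)
        (y - (σ • t + s • ((σ * Real.sin σ / 3) • n))) = 0 :=
  integral_undef (not_integrable_perturbedLine t n y ht hn htn hs)

end NormalVariationJunk

end Summit.NavierStokesRegularity.NavierStokesRegularity.Theorems
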